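import Summits.SmoothPoincare4.SmoothPoincare4.Theorems.InformationMetricHadamardAhHadamardFillingFisherSphereGaussDefs
import Mathlib.Analysis.Calculus.InverseFunctionTheorem.ContDiff
import Mathlib.Analysis.InnerProductSpace.Projection.Basic
import Mathlib.Analysis.Normed.Module.FiniteDimension
import Mathlib.Geometry.Manifold.ContMDiff.Atlas
import Mathlib.Geometry.Manifold.ContMDiff.NormedSpace
import Mathlib.Geometry.Manifold.MFDeriv.Basic

/-!
# Smoothness of a map detected through an injective immersion into a Hilbert space
(crux `InformationMetricHadamard.AhHadamardFilling`, item stmt-SmoothPoincare4-6014, line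
`fisher-sphere-gauss`, stub F `stub_instantonCollarPackage` — the Donaldson–Taubes collar of a model
of the instanton moduli space). This file is the fact-independent differential-topological part of
stub F: the collar `Φ : Σ × ℝ → W` is known to be continuous into the model `W` and smooth as a map
into `L²(Σ)` through the Hellinger map `e = θ_W : W → L²(Σ)`, a smooth immersion of the abstract
5-manifold `W` (the Fisher form is positive definite); `helper_contMDiffOn_of_comp_immersion`
concludes that `Φ` is smooth into `W`.

It is the standard fact that a CONTINUOUS map into an immersed submanifold which is smooth into the
ambient space is smooth (Lee, *Introduction to Smooth Manifolds*, 2nd ed., Thm. 5.29 and its proof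
for immersed submanifolds), here with a real inner product space as ambient space and a
5-dimensional source: locally an immersion `ê : ℝ⁵ → V` is split by the orthogonal projection `π`
onto the (5-dimensional, hence complete) range of its differential, `π ∘ ê` is a local
diffeomorphism by the inverse function theorem, and `(π ∘ ê)⁻¹ ∘ π` is a smooth local left inverse
of `ê` (`exists_contDiffAt_leftInverse_of_injective_fderiv`); composing it with `e ∘ Φ` exhibits
the chart representative of `Φ` as a smooth map near every point of `s`.
Authorship: stub-worker of the line lead prover-line-stmt-SmoothPoincare4-6014-c5-0 (wave 1).

References: J. M. Lee, *Introduction to Smooth Manifolds* (2nd ed. 2013), Thm. 4.12 (immersions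
are local embeddings; rank theorem), Thm. 5.29 (smoothness of maps into submanifolds).
-/

noncomputable section

-- the prescribed namespace `Summit.<P>.<Sub>.…` duplicates `SmoothPoincare4` (P = Sub)
set_option linter.dupNamespace false

open scoped Manifold ContDiff Topology
open Set Function Filter

namespace Summit.SmoothPoincare4.SmoothPoincare4.Cruxes.AhHadamardFilling.FisherSphereGauss

/-- **A smooth immersion at a point has a smooth local left inverse.** If `f : E → V` (`E`
finite-dimensional, `V` a real inner product space) is `C^n` at `a`, `n ≠ 0`, with injective
differential `L = Df(a)`, then some `g : V → E` is `C^n` at `f a` and satisfies `g (f x) = x` for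
all `x` near `a`. Proof: with `T = range L` (finite-dimensional, hence complete) and `π : V → T` the
orthogonal projection, `π ∘ f` has differential `π ∘ L = L` co-restricted to `T`, an isomorphism
`E ≃ T`; the inverse function theorem (`ContDiffAt.localInverse`) gives a `C^n` local inverse `h` of
`π ∘ f`, and `g = h ∘ π`. (Lee 2013, Thm. 4.12.) [cite: LeeSmoothManifolds2013, Thm 4.12] -/
theorem exists_contDiffAt_leftInverse_of_injective_fderiv
    {E : Type*} [NormedAddCommGroup E] [NormedSpace ℝ E] [FiniteDimensional ℝ E]
    {V : Type*} [NormedAddCommGroup V] [InnerProductSpace ℝ V]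
    {f : E → V} {a : E} {n : WithTop ℕ∞} (hf : ContDiffAt ℝ n f a) (hn : n ≠ 0)
    (hinj : Injective (fderiv ℝ f a)) :
    ∃ g : V → E, ContDiffAt ℝ n g (f a) ∧ ∀ᶠ x in 𝓝 a, g (f x) = x := by
  haveI : CompleteSpace E := FiniteDimensional.complete ℝ E
  set L : E →L[ℝ] V := fderiv ℝ f a
  set T : Submodule ℝ V := LinearMap.range (L : E →ₗ[ℝ] V)
  haveI : FiniteDimensional ℝ T := LinearMap.finiteDimensional_range _
  haveI : CompleteSpace T := FiniteDimensional.complete ℝ T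
  set π : V →L[ℝ] T := T.orthogonalProjectionOnto
  have hLinj : Injective (L : E →ₗ[ℝ] V) := hinj
  set A : E ≃L[ℝ] T := (LinearEquiv.ofInjective (L : E →ₗ[ℝ] V) hLinj).toContinuousLinearEquiv
  -- `π ∘ L` is `L` co-restricted to its range, i.e. the equivalence `A`
  have hA : π.comp L = (A : E →L[ℝ] T) := by
    refine ContinuousLinearMap.ext fun x ↦ ?_
    have hx : ((A x : T) : V) = L x := rfl
    rw [ContinuousLinearMap.comp_apply, ContinuousLinearEquiv.coe_coe, ← hx]
    exact Submodule.orthogonalProjectionOnto_mem_subspace_eq_self (A x)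
  -- the inverse function theorem for `π ∘ f`
  have hF : ContDiffAt ℝ n (π ∘ f) a := π.contDiff.contDiffAt.comp a hf
  have hF' : HasFDerivAt (π ∘ f) (A : E →L[ℝ] T) a := by
    rw [← hA]
    exact π.hasFDerivAt.comp a (hf.differentiableAt hn).hasFDerivAt
  refine ⟨hF.localInverse hF' hn ∘ π, ?_, ?_⟩
  · exact (hF.to_localInverse hF' hn).comp (f a) π.contDiff.contDiffAt
  · exact (hF.hasStrictFDerivAt' hF' hn).eventually_left_inverse

/-- **Smoothness through an injective immersion** (helper of stub F `stub_instantonCollarPackage`).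
Let `W` be a `C^∞` 5-manifold and `e : W → V` a `C^∞` map into a real inner product space whose
differential `mfderiv e w` is injective at every point (an immersion). If `Φ : P → W` is continuous
on an open set `s` of a manifold `P` and `e ∘ Φ` is `C^∞` on `s`, then `Φ` is `C^∞` on `s`.
Proof: at `p ∈ s`, read `e` in the chart `φ` of `W` at `w = Φ p`; the representative `ê = e ∘ φ⁻¹`
is `C^∞` near `φ w` with injective differential (`= mfderiv e w`), so it has a `C^∞` local left
inverse `g` (`exists_contDiffAt_leftInverse_of_injective_fderiv`); by continuity of `Φ` within `s`,
`φ ∘ Φ = g ∘ (e ∘ Φ)` near `p` within `s`, which is `C^∞`; conclude by the target-chart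
characterisation `contMDiffWithinAt_iff_target`. (Lee 2013, Thm. 5.29, whose continuity hypothesis
is exactly `hΦc`; no injectivity of `e` itself is needed.)
[cite: LeeSmoothManifolds2013, Thm 5.29] -/
theorem helper_contMDiffOn_of_comp_immersion
    {EP : Type*} [NormedAddCommGroup EP] [NormedSpace ℝ EP] {HP : Type*} [TopologicalSpace HP]
    {IP : ModelWithCorners ℝ EP HP} {P : Type*} [TopologicalSpace P] [ChartedSpace HP P]
    {W : Type*} [TopologicalSpace W] [ChartedSpace (EuclideanSpace ℝ (Fin 5)) W]
    [IsManifold (𝓡 5) ∞ W]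
    {V : Type*} [NormedAddCommGroup V] [InnerProductSpace ℝ V]
    {e : W → V} (he : ContMDiff (𝓡 5) 𝓘(ℝ, V) ∞ e)
    (hinj : ∀ w, Function.Injective (mfderiv (𝓡 5) 𝓘(ℝ, V) e w))
    {Φ : P → W} {s : Set P} (hs : IsOpen s) (hΦc : ContinuousOn Φ s)
    (hΦe : ContMDiffOn IP 𝓘(ℝ, V) ∞ (e ∘ Φ) s) :
    ContMDiffOn IP (𝓡 5) ∞ Φ s := by
  intro p hp
  have hn : (∞ : WithTop ℕ∞) ≠ 0 := by simp
  -- the base point `w`, its preferred extended chart `φ`, and `e` read in the chart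
  set w : W := Φ p
  set φ : PartialEquiv W (EuclideanSpace ℝ (Fin 5)) := extChartAt (𝓡 5) w with hφ_def
  have hê : ContDiffAt ℝ ∞ (e ∘ φ.symm) (φ w) :=
    ((he.comp_contMDiffOn (contMDiffOn_extChartAt_symm w)).contDiffOn).contDiffAt
      ((isOpen_extChartAt_target w).mem_nhds (mem_extChartAt_target w))
  -- its differential at `φ w` is `mfderiv e w`, which is injective
  have hL : mfderiv (𝓡 5) 𝓘(ℝ, V) e w = fderiv ℝ (e ∘ φ.symm) (φ w) := by
    rw [(he.mdifferentiableAt hn).mfderiv]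
    simp only [writtenInExtChartAt, ModelWithCorners.range_eq_univ, fderivWithin_univ]
    rfl
  have hLinj : Injective (fderiv ℝ (e ∘ φ.symm) (φ w)) := by
    have h := hinj w
    rw [hL] at h
    exact h
  -- a smooth local left inverse `g` of `e ∘ φ.symm` near `φ w`
  obtain ⟨g, hg, hgf⟩ := exists_contDiffAt_leftInverse_of_injective_fderiv hê hn hLinj
  have hw : (e ∘ φ.symm) (φ w) = e w := by
    simp only [hφ_def, Function.comp_apply, extChartAt_to_inv]
  rw [hw] at hg
  -- continuity: near `p` within `s`, `Φ q` lies in the chart domain and `φ (Φ q)` is close to `φ w`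
  have hΦp : ContinuousWithinAt Φ s p := (hΦc.continuousAt (hs.mem_nhds hp)).continuousWithinAt
  have hφΦ : ContinuousWithinAt (φ ∘ Φ) s p :=
    (continuousAt_extChartAt w).comp_continuousWithinAt hΦp
  have hev : (φ ∘ Φ) =ᶠ[𝓝[s] p] (g ∘ (e ∘ Φ)) := by
    have h1 : ∀ᶠ q in 𝓝[s] p, Φ q ∈ φ.source :=
      hΦp.preimage_mem_nhdsWithin (extChartAt_source_mem_nhds w)
    have h2 : ∀ᶠ q in 𝓝[s] p, g ((e ∘ φ.symm) ((φ ∘ Φ) q)) = (φ ∘ Φ) q :=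
      hφΦ.tendsto.eventually hgf
    filter_upwards [h1, h2] with q hq1 hq2
    simp only [Function.comp_apply] at hq2 ⊢
    rw [φ.left_inv hq1] at hq2
    exact hq2.symm
  -- the right-hand side `g ∘ (e ∘ Φ)` is smooth within `s` at `p`
  have hsm : ContMDiffWithinAt IP 𝓘(ℝ, EuclideanSpace ℝ (Fin 5)) ∞ (g ∘ (e ∘ Φ)) s p :=
    ContDiffAt.comp_contMDiffWithinAt (f := e ∘ Φ) (x := p) hg (hΦe p hp)
  -- conclusion through the target-chart characterisation of smoothness
  rw [contMDiffWithinAt_iff_target]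
  exact ⟨hΦp, hsm.congr_of_eventuallyEq hev (hev.eq_of_nhdsWithin hp)⟩

end Summit.SmoothPoincare4.SmoothPoincare4.Cruxes.AhHadamardFilling.FisherSphereGauss
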